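import Literature.IUT.LogThetaLattice.GlobalLGPFrobenioidsRealification
import Literature.IUT.LogThetaLattice.GlobalFrobenioidModelsLogVolume
import Literature.IUT.LogVolume.PrincipalArithmeticDivisorsSpan
import HarnessLib

/-!
# [IUTchIII] Proposition 3.7 (ii) «(†𝓕⊛ℝ_𝔪𝔬𝔡)_α» at the model, A: the rational function monoid `ℝ · Φ^birat` of
# the REALIFICATION ([FrdI] Prop. 5.3) of the fractional-ideal Frobenioid of a number field, its Dirichlet
# characterisation, and the `F^×`-enlargement

abc-iut cell, layer L6, wave-5 seat abc-iut-w5-d153; part A of the repair R2 of the audit findings F-w5d153-1 ≡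
F-w5d161-1 on `GlobalLGPFrobenioidsRealification.lean` (abc-iut-w4-d005, p412933: its codomain
`FrakCat F (ModelPlaces F) (fun _ => ℝ) nonnegModel betaModel` keeps the rational function monoid `F^×_mod` — it is
the `ℝ`-divisor ENLARGEMENT of `(†𝓕⊛_𝔪𝔬𝔡)_α`, not yet the realification) and of the «category-level realification»
residual named in `ThetaPilotObjectsFrakModel.lean` (abc-iut-w4-d015). Part B (`GlobalLGPFrobenioidsRealifiedModel
.lean`) builds the category `FrakRlfCat F` = `(†𝓕⊛ℝ_𝔪𝔬𝔡)_α`, classifies its isomorphism classes by the degree, and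
defines the realification functor.

PRINT. S. Mochizuki, *Inter-universal Teichmüller Theory III*, kurims manuscript (May 2020), Prop. 3.7 (ii)
p. 110 l. 48–49: "Write `(†𝓕⊛ℝ_𝔪𝔬𝔡)_α` for the realification of `(†𝓕⊛_𝔪𝔬𝔡)_α`" [claim key Mochizuki2012, status
disputed (D-0012)]; Rmk. 3.6.2 (i) p. 109: "the isomorphism classes of the sort of Frobenioids that appear in
this context are determined by the divisor and rational function monoids of the [model] Frobenioid in question
[cf. the constructions given in [FrdI], Theorem 5.2, (i), (ii)] … [the union with `{0}` of] `F^×_mod` admits a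
natural additive structure … this property is not satisfied by (a) the rational function monoids of the
perfection or realification of `𝓕⊛_mod`". S. Mochizuki, *The geometry of Frobenioids I*, Kyushu J. Math. 62
(2008), Prop. 5.3 p. 103 [cite: MochizukiFrdI2008, Prop. 5.3 p.103]: "we shall refer to as the realification
`𝒞^rlf` of the Frobenioid `𝒞` the model Frobenioid [cf. Theorem 5.2, (ii)] associated to the divisor monoid
`Φ^rlf` [i.e., the 'realification' of Definition 2.4, (i)] and the rational function monoid `ℝ · Φ^birat ⊆
(Φ^rlf)^gp` [i.e., for `A_𝒟 ∈ Ob(𝒟)`, `(ℝ · Φ^birat)(A_𝒟)` is the `ℝ`-vector subspace of `(Φ^rlf)^gp(A_𝒟)`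
generated by `Φ^birat(A_𝒟)`]"; Def. 2.4 (i) p. 48 ("`(M^rlf)^gp … is an `ℝ`-vector space")
[cite: MochizukiFrdI2008, Def. 2.4 (i) p.48]; Thm. 6.4 (i) p. 115 l. 28–32 (the `ℝ`-span of the principal
divisors = the degree-`0` part, "a consequence of the well-known Dirichlet unit theorem")
[cite: MochizukiFrdI2008, Thm. 6.4 (i) p.115].

THE MODEL (every input BY NAME). Base category = the one-morphism category (Ex. 3.6 (ii) p. 108 l. 8);
`Φ = ⊕'_v Γ_v^{≥0}` with `Γ_v = ℤ` (finite `v`) / `ℝ` (archimedean `v`) (abc-iut-w4-d005's integral datum), hence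
`Φ^rlf = ⊕'_v ℝ_{≥0}` (Def. 2.4 (i), finite support) and `(Φ^rlf)^gp = ⊕'_v ℝ` = abc-iut-L6-d3's `ModelFrakObj F`
(abc-iut-L6-t4's `FrakObj` over abc-iut-L6-d1's places data `ModelPlaces F`, `betaModel`, `nonnegModel`);
`Φ^birat` = image of `Div_𝔹 : F^× → Φ^gp`, `f ↦ (β_v(f))_v` (abc-iut-L6-t6's `betaDiv`); the dictionary
`(Φ^rlf)^gp ≅ ADiv_ℝ(F)` is abc-iut-L6-d3's `frakDivisor` / `frakObjEquivADivisor` (coordinates `−[F_v:ℝ]·[λ_v]`,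
`−[λ_v]`), under which `Div(f) ↦ −ADiv(f)`; `deg` = `frakDeg := deg_F ∘ frakDivisor`.

CONTENTS (no `Prop`-valued definition; every statement proved):
* `frakDivisorHom` (the dictionary is additive), `frakDeg_add/_sub/_zero`; `prinFamily f := Div(f)` with
  `frakDivisor_prinFamily : frakDivisor (Div f) = −ADiv(f)`, `frakDeg_prinFamily = 0`, `prinFamily_neg_one = 0`
  (the torsion `μ(F) ⊆ F^×` dies in `(Φ^rlf)^gp`);
* `rscale r` — the `ℝ`-vector space structure of `(Φ^rlf)^gp`, `frakDivisor_rscale`, `frakDeg_rscale`;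
* `realRatFn F : AddSubgroup (ModelFrakObj F)` — **`ℝ · Φ^birat`** (families whose divisor lies in
  `Submodule.span ℝ (APrc F)`, campaign-S vocabulary), `prinFamily_mem_realRatFn`, `rscale_mem_realRatFn`,
  the minimality `realRatFn_le` (it IS the subgroup generated by the `r • Div(f)` — print's "generated by
  `Φ^birat`"), and the DIRICHLET characterisation **`mem_realRatFn_iff_frakDeg_eq_zero : u ∈ ℝ·Φ^birat ↔
  frakDeg u = 0`** (⇐ abc-iut-L1-t3's `span_APrc_eq_ker_degF`, BY NAME);
* the `F^×`-enlargement (abc-iut-w4-d005's codomain): `prinFamily_add_nsmul_sub_mem_effDiv_iff` (its integrality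
  condition = effectivity of `Div(f) + n•𝔍₁ − 𝔍₂`), `isHom_negOne` / `homMk_negOne_ne_id` (`(1, −1) ≠ 𝟙` is an
  endomorphism of every object: the enlargement remembers `f`, not `Div(f)`), and
  **`exists_frakDeg_eq_not_iso_enlargement`**: `𝒪` and `½·Div(π)` (`π` a uniformiser) have equal degree but are NOT
  isomorphic there (an isomorphism would be an `f ∈ F^×` with `ord_w(f) = ½`) — whereas in `(†𝓕⊛ℝ_𝔪𝔬𝔡)_α` (part B)
  equal degree ⟺ isomorphic.

Nothing here asserts a disputed claim or takes a side on [IUTchIII] Cor. 3.12; typed ≠ discharged; instantiated ≠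
endorsed.
-/

noncomputable section

namespace Literature.IUT.LogThetaLattice

namespace Prop37

open CategoryTheory NumberField IsDedekindDomain GlobalFrobenioidModels Literature.IUT.LogVolume

variable (F : Type) [Field F] [NumberField F]

/-! ### The dictionary `(Φ^rlf)^gp = ModelFrakObj F ≅ ADiv_ℝ(F)` is additive; principal families -/

/-- abc-iut-L6-d3's `frakDivisor` as an additive homomorphism `(Φ^rlf)^gp → ADiv_ℝ(F)` (coordinates are
`ℤ`-linear in the classes). [cite: MochizukiFrdI2008, Prop. 5.3 p.103] -/
def frakDivisorHom : ModelFrakObj F →+ ADivisor F where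
  toFun := frakDivisor
  map_zero' := by
    ext p
    rw [frakDivisor_apply, FrakObj.cls_zero, mul_zero, neg_zero, Finsupp.zero_apply]
  map_add' J₁ J₂ := by
    ext p
    simp only [frakDivisor_apply, Finsupp.add_apply, FrakObj.cls_add]
    ring

/-- `frakDivisorHom` is `frakDivisor`. [cite: MochizukiFrdI2008, Prop. 5.3 p.103] -/
@[simp] theorem frakDivisorHom_apply (J : ModelFrakObj F) : frakDivisorHom F J = frakDivisor J := rfl

/-- `frakDivisor` is injective (abc-iut-L6-d3's `frakObjEquivADivisor`). [cite: MochizukiFrdI2008, Prop. 5.3 p.103] -/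
theorem frakDivisor_injective : Function.Injective (frakDivisor (F := F)) :=
  (frakObjEquivADivisor (F := F)).injective

/-- The arithmetic degree of a real family is additive. [cite: MochizukiFrdI2008, Prop. 5.3 p.103] -/
theorem frakDeg_add (J₁ J₂ : ModelFrakObj F) : frakDeg (J₁ + J₂) = frakDeg J₁ + frakDeg J₂ := by
  show degF F (frakDivisorHom F (J₁ + J₂)) = degF F (frakDivisorHom F J₁) + degF F (frakDivisorHom F J₂)
  rw [map_add, map_add]

/-- The arithmetic degree of a real family is additive (subtraction). [cite: MochizukiFrdI2008, Prop. 5.3 p.103] -/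
theorem frakDeg_sub (J₁ J₂ : ModelFrakObj F) : frakDeg (J₁ - J₂) = frakDeg J₁ - frakDeg J₂ := by
  show degF F (frakDivisorHom F (J₁ - J₂)) = degF F (frakDivisorHom F J₁) - degF F (frakDivisorHom F J₂)
  rw [map_sub, map_sub]

/-- `frakDeg 0 = 0`. [cite: MochizukiFrdI2008, Prop. 5.3 p.103] -/
theorem frakDeg_zero : frakDeg (0 : ModelFrakObj F) = 0 := by
  show degF F (frakDivisorHom F 0) = 0
  rw [map_zero, map_zero]

/-- `Div(f) ∈ Φ^birat ⊆ (Φ^rlf)^gp`: the principal family `(β_v(f))_v` of `f ∈ F^×` (abc-iut-L6-t6's `betaDiv` at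
abc-iut-L6-d1's model data; finiteness = abc-iut-w4-d005's `modelHyps_places`). [cite: MochizukiFrdI2008, Thm. 5.2 p.100] -/
abbrev prinFamily (f : Fˣ) : ModelFrakObj F :=
  Multiplicative.toAdd (betaDiv (F := F) (V := ModelPlaces F) (Γ := fun _ => ℝ) (nonneg := nonnegModel)
    (β := betaModel) (modelHyps_places F) f)

/-- `prinFamily` is a group homomorphism `F^× → (Φ^rlf)^gp` (products ↦ sums). [cite: MochizukiFrdI2008, Thm. 5.2 p.100] -/
theorem prinFamily_mul (f g : Fˣ) : prinFamily F (f * g) = prinFamily F f + prinFamily F g := by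
  rw [prinFamily, map_mul, toAdd_mul]

/-- `prinFamily 1 = 0`. [cite: MochizukiFrdI2008, Thm. 5.2 p.100] -/
theorem prinFamily_one : prinFamily F 1 = 0 := by
  rw [prinFamily, map_one, toAdd_one]

/-- `prinFamily (f ^ n) = n • prinFamily f`. [cite: MochizukiFrdI2008, Thm. 5.2 p.100] -/
theorem prinFamily_pow (f : Fˣ) (n : ℕ) : prinFamily F (f ^ n) = n • prinFamily F f := by
  rw [prinFamily, map_pow, toAdd_pow]

/-- Under the dictionary, `Div(f) ↦ −ADiv(f)` (abc-iut-L6-d3's sign convention `−[λ_v]`).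
[cite: MochizukiFrdI2008, Prop. 5.3 p.103] -/
theorem frakDivisor_prinFamily (f : Fˣ) : frakDivisor (prinFamily F f) = -ADivisor.principal (f : F) := by
  ext p
  rw [frakDivisor_apply, Finsupp.neg_apply]
  rcases p with v | w
  · rw [Sum.swap_inl, placeMult_inl, cls_betaDiv, mult_mul_betaModel_inr_apply]
  · rw [Sum.swap_inr, placeMult_inr, one_mul, cls_betaDiv, betaModel_inl_apply]

/-- Hence `deg(Div f) = 0` (product formula, campaign S `degF_principal`). [cite: MochizukiFrdI2008, Prop. 5.3 p.103] -/
theorem frakDeg_prinFamily (f : Fˣ) : frakDeg (prinFamily F f) = 0 := by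
  show degF F (frakDivisor (prinFamily F f)) = 0
  rw [frakDivisor_prinFamily, map_neg, degF_principal, neg_zero]

/-- The torsion of `F^×` dies in `(Φ^rlf)^gp`: `Div(−1) = 0` (`β_v(−1) = 0` at every place since `Γ_v = ℝ` is
torsion-free). [cite: MochizukiFrdI2008, Prop. 5.3 p.103] -/
theorem prinFamily_neg_one : prinFamily F (-1) = 0 := by
  have h2 : (2 : ℕ) • prinFamily F (-1) = 0 := by
    rw [← prinFamily_pow, neg_one_sq, prinFamily_one]
  refine FrakObj.ext_cls (funext fun v => ?_)
  have hv := congrArg (fun J : ModelFrakObj F => J.cls v) h2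
  simp only [FrakObj.cls_zero, two_nsmul] at hv
  exact add_self_eq_zero.mp hv

/-! ### Real scalings of families (the `ℝ`-vector space structure of `(Φ^rlf)^gp = ⊕'_v ℝ`) -/

/-- The `ℝ`-vector space structure of `(Φ^rlf)^gp` ([FrdI] Def. 2.4 (i): "`(M^rlf)^gp … is an `ℝ`-vector space"):
scaling a finitely supported real family by `r ∈ ℝ`. [cite: MochizukiFrdI2008, Def. 2.4 (i) p.48] -/
def rscale (r : ℝ) (J : ModelFrakObj F) : ModelFrakObj F :=
  ⟨fun v => r * J.cls v, J.finite.subset fun v hv => by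
    intro h0
    exact hv (by simp only [h0, mul_zero])⟩

/-- Classes of a scaled family. [cite: MochizukiFrdI2008, Def. 2.4 (i) p.48] -/
@[simp] theorem rscale_cls (r : ℝ) (J : ModelFrakObj F) (v : ModelPlaces F) : (rscale F r J).cls v = r * J.cls v :=
  rfl

/-- The dictionary is `ℝ`-linear: `frakDivisor (r • 𝔍) = r • frakDivisor 𝔍`. [cite: MochizukiFrdI2008, Def. 2.4 (i) p.48] -/
theorem frakDivisor_rscale (r : ℝ) (J : ModelFrakObj F) : frakDivisor (rscale F r J) = r • frakDivisor J := by
  ext p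
  rw [frakDivisor_apply, Finsupp.smul_apply, frakDivisor_apply, rscale_cls, smul_eq_mul]
  ring

/-- `frakDeg (r • 𝔍) = r · frakDeg 𝔍`. [cite: MochizukiFrdI2008, Def. 2.4 (i) p.48] -/
theorem frakDeg_rscale (r : ℝ) (J : ModelFrakObj F) : frakDeg (rscale F r J) = r * frakDeg J := by
  show degF F (frakDivisor (rscale F r J)) = r * degF F (frakDivisor J)
  rw [frakDivisor_rscale, map_smul, smul_eq_mul]

/-! ### `ℝ · Φ^birat`, the rational function monoid of the realification ([FrdI] Prop. 5.3) -/

/-- **`ℝ · Φ^birat ⊆ (Φ^rlf)^gp`** ([FrdI] Prop. 5.3 p. 103: "the `ℝ`-vector subspace of `(Φ^rlf)^gp(A_𝒟)` generated by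
`Φ^birat(A_𝒟)`"), read through the dictionary `(Φ^rlf)^gp ≅ ADiv_ℝ(F)`: the real families whose arithmetic
divisor lies in the `ℝ`-span of the principal divisors `APrc(F)` (campaign S). That this IS the subgroup
generated by the real scalings of the principal families is `realRatFn_le` / `rscale_prinFamily_mem_realRatFn`.
[cite: MochizukiFrdI2008, Prop. 5.3 p.103] -/
def realRatFn : AddSubgroup (ModelFrakObj F) :=
  (Submodule.span ℝ ((APrc F : AddSubgroup (ADivisor F)) : Set (ADivisor F))).toAddSubgroup.comap
    (frakDivisorHom F)

/-- Membership in `ℝ · Φ^birat`, unfolded. [cite: MochizukiFrdI2008, Prop. 5.3 p.103] -/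
theorem mem_realRatFn_iff (u : ModelFrakObj F) :
    u ∈ realRatFn F ↔
      frakDivisor u ∈ Submodule.span ℝ ((APrc F : AddSubgroup (ADivisor F)) : Set (ADivisor F)) :=
  Iff.rfl

/-- **Dirichlet's unit theorem, in the form the realification uses**: a real family lies in `ℝ · Φ^birat` iff its
arithmetic degree vanishes (abc-iut-L1-t3's `span_APrc_eq_ker_degF`, [FrdI] Thm. 6.4 (i) p. 115 l. 28–32 "a
consequence of the well-known Dirichlet unit theorem", consumed BY NAME). [cite: MochizukiFrdI2008, Thm. 6.4 (i) p.115] -/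
theorem mem_realRatFn_iff_frakDeg_eq_zero (u : ModelFrakObj F) : u ∈ realRatFn F ↔ frakDeg u = 0 := by
  rw [mem_realRatFn_iff, span_APrc_eq_ker_degF, LinearMap.mem_ker]
  rfl

/-- `Φ^birat ⊆ ℝ · Φ^birat`: every principal family is a real rational function. [cite: MochizukiFrdI2008, Prop. 5.3 p.103] -/
theorem prinFamily_mem_realRatFn (f : Fˣ) : prinFamily F f ∈ realRatFn F := by
  rw [mem_realRatFn_iff, frakDivisor_prinFamily]
  refine Submodule.neg_mem _ (Submodule.subset_span ?_)
  exact ⟨(f : F), f.ne_zero, rfl⟩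

/-- `ℝ · Φ^birat` is an `ℝ`-subspace: closed under real scalings. [cite: MochizukiFrdI2008, Prop. 5.3 p.103] -/
theorem rscale_mem_realRatFn (r : ℝ) {u : ModelFrakObj F} (hu : u ∈ realRatFn F) : rscale F r u ∈ realRatFn F := by
  rw [mem_realRatFn_iff] at hu ⊢
  rw [frakDivisor_rscale]
  exact Submodule.smul_mem _ r hu

/-- The generators `r • Div(f)` of `ℝ · Φ^birat`. [cite: MochizukiFrdI2008, Prop. 5.3 p.103] -/
theorem rscale_prinFamily_mem_realRatFn (r : ℝ) (f : Fˣ) : rscale F r (prinFamily F f) ∈ realRatFn F :=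
  rscale_mem_realRatFn F r (prinFamily_mem_realRatFn F f)

/-- Scalings compose. [cite: MochizukiFrdI2008, Def. 2.4 (i) p.48] -/
theorem rscale_rscale (r s : ℝ) (J : ModelFrakObj F) : rscale F r (rscale F s J) = rscale F (r * s) J :=
  FrakObj.ext_cls (funext fun v => by simp only [rscale_cls, mul_assoc])

/-- `1 • 𝔍 = 𝔍`. [cite: MochizukiFrdI2008, Def. 2.4 (i) p.48] -/
theorem rscale_one (J : ModelFrakObj F) : rscale F 1 J = J :=
  FrakObj.ext_cls (funext fun v => by simp only [rscale_cls, one_mul])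

/-- **`ℝ · Φ^birat` is GENERATED by the `r • Div(f)`** ("the `ℝ`-vector subspace … generated by `Φ^birat(A_𝒟)`"):
it is contained in — hence is the smallest — subgroup of `(Φ^rlf)^gp` containing every real scaling of every
principal family. [cite: MochizukiFrdI2008, Prop. 5.3 p.103] -/
theorem realRatFn_le (S : AddSubgroup (ModelFrakObj F))
    (hS : ∀ (r : ℝ) (f : Fˣ), rscale F r (prinFamily F f) ∈ S) : realRatFn F ≤ S := by
  intro u hu
  rw [mem_realRatFn_iff] at hu
  -- pull the span induction back along the additive, `ℝ`-linear bijection `frakDivisor`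
  let e : ModelFrakObj F ≃ ADivisor F := frakObjEquivADivisor
  have he : ∀ J : ModelFrakObj F, e J = frakDivisor J := fun _ => rfl
  have hsymm_add : ∀ a b : ADivisor F, e.symm (a + b) = e.symm a + e.symm b := fun a b =>
    e.injective (by
      rw [Equiv.apply_symm_apply, he, ← frakDivisorHom_apply, map_add, frakDivisorHom_apply,
        frakDivisorHom_apply, ← he, ← he, Equiv.apply_symm_apply, Equiv.apply_symm_apply])
  have hsymm_zero : e.symm 0 = 0 :=
    e.injective (by rw [Equiv.apply_symm_apply, he, ← frakDivisorHom_apply, map_zero])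
  have hsymm_smul : ∀ (r : ℝ) (a : ADivisor F), e.symm (r • a) = rscale F r (e.symm a) := fun r a =>
    e.injective (by rw [Equiv.apply_symm_apply, he, frakDivisor_rscale, ← he, Equiv.apply_symm_apply])
  have key : ∀ a ∈ Submodule.span ℝ ((APrc F : AddSubgroup (ADivisor F)) : Set (ADivisor F)),
      ∀ r : ℝ, e.symm (r • a) ∈ S := by
    intro a ha
    induction ha using Submodule.span_induction with
    | mem x hx =>
      intro r
      obtain ⟨f, hf, rfl⟩ := hx
      have : e.symm (r • ADivisor.principal f) = rscale F (-r) (prinFamily F (Units.mk0 f hf)) :=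
        e.injective (by
          rw [Equiv.apply_symm_apply, he, frakDivisor_rscale, frakDivisor_prinFamily, Units.val_mk0, smul_neg,
            neg_smul, neg_neg])
      rw [this]
      exact hS (-r) _
    | zero => intro r; rw [smul_zero, hsymm_zero]; exact S.zero_mem
    | add x y _ _ hx hy => intro r; rw [smul_add, hsymm_add]; exact S.add_mem (hx r) (hy r)
    | smul s x _ hx => intro r; rw [smul_smul]; exact hx (r * s)
  have hu1 := key (frakDivisor u) hu 1
  rwa [one_smul, ← he, Equiv.symm_apply_apply] at hu1

/-! ### Effectivity at the model and the `F^×`-enlargement `FrakCat F (ModelPlaces F) ℝ …` -/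

/-- Effectivity of a real family at the model: all classes `≥ 0` (abc-iut-L6-t6's `effDiv` at abc-iut-L6-d1's
`nonnegModel`). [cite: MochizukiFrdI2008, Thm. 5.2 p.100] -/
theorem mem_effDiv_model_iff (D : ModelFrakObj F) :
    D ∈ effDiv (ModelPlaces F) (fun _ => ℝ) nonnegModel ↔ ∀ v, 0 ≤ D.cls v :=
  Iff.rfl

/-- The integrality condition of abc-iut-L6-t6's `FrakCat` over the real places data, as effectivity of the family
`Div(f) + n•𝔍₁ − 𝔍₂`. [cite: MochizukiFrdI2008, Thm. 5.2 p.100] -/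
theorem prinFamily_add_nsmul_sub_mem_effDiv_iff (J₁ J₂ : ModelFrakObj F) (n : ℕ+) (f : Fˣ) :
    prinFamily F f + (n : ℕ) • J₁ - J₂ ∈ effDiv (ModelPlaces F) (fun _ => ℝ) nonnegModel ↔
      FrakObj.IsHom (nonneg := nonnegModel) (β := betaModel) J₁ J₂ n f := by
  rw [mem_effDiv_model_iff, isHom_iff]
  refine forall_congr' fun v => ?_
  rw [FrakObj.cls_sub, FrakObj.cls_add, FrakObj.cls_nsmul, cls_betaDiv, natCast_zsmul]
  exact (AddSubmonoid.mem_nonneg (a := _)).symm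

/-- `(1, −1)` is an endomorphism of every object of the enlargement (`β_v(−1) = 0`).
[cite: MochizukiFrdI2008, Prop. 5.3 p.103] -/
theorem isHom_negOne (X : FrakCat F (ModelPlaces F) (fun _ => ℝ) nonnegModel betaModel) :
    FrakObj.IsHom (nonneg := nonnegModel) (β := betaModel) X.obj X.obj 1 (-1) := by
  rw [← prinFamily_add_nsmul_sub_mem_effDiv_iff, prinFamily_neg_one, PNat.one_coe, one_nsmul, zero_add, sub_self]
  exact (effDiv (ModelPlaces F) (fun _ => ℝ) nonnegModel).zero_mem

/-- `(1, −1) ≠ 𝟙` in the enlargement (`−1 ≠ 1` in a number field). [cite: MochizukiFrdI2008, Prop. 5.3 p.103] -/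
theorem homMk_negOne_ne_id (X : FrakCat F (ModelPlaces F) (fun _ => ℝ) nonnegModel betaModel) :
    FrakCat.homMk 1 (-1) (isHom_negOne F X) ≠ 𝟙 X := by
  intro h
  have h' : (-1 : Fˣ) = 1 := by
    have := congrArg FrakCat.fn h
    rwa [FrakCat.fn_homMk, FrakCat.fn_id] at this
  have h'' : ((-1 : Fˣ) : F) = ((1 : Fˣ) : F) := congrArg Units.val h'
  rw [Units.val_neg, Units.val_one] at h''
  have h2 : (2 : F) = 0 := by linear_combination -h''
  exact two_ne_zero h2

/-- **In the `F^×`-enlargement, equal degree does NOT imply isomorphic** (contrast with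
`FrakRlfCat.nonempty_iso_iff_frakDeg_eq`): for a `w`-uniformiser `π`, the object `½·Div(π)` has degree `0` like
`𝒪`, but an isomorphism `𝒪 ≅ ½·Div(π)` there would be an `f ∈ F^×` with `ord_w(f) = ½`.
[cite: MochizukiFrdI2008, Prop. 5.3 p.103] -/
theorem exists_frakDeg_eq_not_iso_enlargement (w : HeightOneSpectrum (𝓞 F)) :
    ∃ X Y : FrakCat F (ModelPlaces F) (fun _ => ℝ) nonnegModel betaModel,
      frakDeg X.obj = frakDeg Y.obj ∧ IsEmpty (X ≅ Y) := by
  obtain ⟨π₀, hπ⟩ := Literature.IUT.LogVolume.exists_ord_eq_one F w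
  have hπ0 : π₀ ≠ 0 := by
    rintro rfl
    rw [Literature.IUT.LogVolume.ord_zero] at hπ
    exact zero_ne_one hπ
  set π : Fˣ := Units.mk0 π₀ hπ0 with hπdef
  let J : ModelFrakObj F := rscale F (1 / 2) (prinFamily F π)
  refine ⟨FrakCat.of 0, FrakCat.of J, ?_, ⟨fun e => ?_⟩⟩
  · show frakDeg (0 : ModelFrakObj F) = frakDeg (rscale F (1 / 2) (prinFamily F π))
    rw [frakDeg_zero, frakDeg_rscale, frakDeg_prinFamily, mul_zero]
  have hJw : J.cls (Sum.inl w) = 1 / 2 := by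
    show (1 / 2 : ℝ) * betaModel (Sum.inl w : ModelPlaces F) (Additive.ofMul π) = 1 / 2
    rw [betaModel_inl_eq_cast_beta]
    have : (beta F (.inr (FinitePlace.mk w)) (Additive.ofMul π) : ℤ) = 1 := by
      rw [beta_inr, Literature.IUT.LogVolume.ordFin_mk_eq_ord]
      simpa [hπdef] using hπ
    rw [this]
    norm_num
  have h1 := FrakCat.mem_nonneg e.hom (Sum.inl w)
  have h2 := FrakCat.mem_nonneg e.inv (Sum.inl w)
  have hfg : FrakCat.fn e.inv * FrakCat.fn e.hom ^ ((FrakCat.deg e.inv : ℕ)) = 1 := by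
    have := congrArg FrakCat.fn e.hom_inv_id
    rwa [FrakCat.fn_comp, FrakCat.fn_id] at this
  set b : ℝ := betaModel (Sum.inl w : ModelPlaces F) (Additive.ofMul (FrakCat.fn e.hom)) with hb
  have hbg : betaModel (Sum.inl w : ModelPlaces F) (Additive.ofMul (FrakCat.fn e.inv)) =
      -((FrakCat.deg e.inv : ℕ) : ℝ) * b := by
    have := congrArg (fun u : Fˣ => betaModel (Sum.inl w : ModelPlaces F) (Additive.ofMul u)) hfg
    simp only [ofMul_mul, ofMul_pow, map_add, map_nsmul, ofMul_one, map_zero, nsmul_eq_mul] at this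
    linarith
  have h1' : (1 / 2 : ℝ) ≤ b := by
    have h1r := (AddSubmonoid.mem_nonneg).mp h1
    simp only [FrakCat.obj_of, FrakObj.cls_zero, smul_zero, add_zero, hJw] at h1r
    linarith
  have h2' : b ≤ 1 / 2 := by
    have h2r := (AddSubmonoid.mem_nonneg).mp h2
    simp only [FrakCat.obj_of, FrakObj.cls_zero, sub_zero, hJw, hbg, zsmul_eq_mul] at h2r
    push_cast at h2r
    have hm : (1 : ℝ) ≤ ((FrakCat.deg e.inv : ℕ) : ℝ) := by exact_mod_cast (FrakCat.deg e.inv).pos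
    nlinarith
  have hbhalf : b = 1 / 2 := le_antisymm h2' h1'
  have hbint : b = (Literature.IUT.LogVolume.ord F w (FrakCat.fn e.hom : F) : ℝ) := by
    rw [hb]
    exact betaFin_apply w _
  rw [hbint] at hbhalf
  have h2z : (2 : ℝ) * (Literature.IUT.LogVolume.ord F w (FrakCat.fn e.hom : F) : ℝ) = 1 := by
    rw [hbhalf]; norm_num
  have : (2 * Literature.IUT.LogVolume.ord F w (FrakCat.fn e.hom : F) : ℤ) = 1 := by exact_mod_cast h2z
  omega

end Prop37

end Literature.IUT.LogThetaLattice

end
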